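import Literature.Computability.AlgebraicComplexity.BI17FundamentalInvariantForms
import Mathlib.Algebra.MvPolynomial.Funext
import Mathlib.LinearAlgebra.Matrix.SchurComplement
import Mathlib.Tactic.Module
import HarnessLib

/-!
# Generic quadratic forms have stabilizer period `2` (Bürgisser–Ikenmeyer 2017, §2.1): discharge

Sibling proof file of `Literature/Computability/AlgebraicComplexity/BI17FundamentalInvariantForms.lean`
(cell `val-lit`, DAG row BI17-A), discharging its named fact
`Literature.Computability.AlgebraicComplexity.BI2017_rem_quadratic_period`: "`a(2,m) = 2`", i.e.
almost all quadratic forms `w ∈ Sym² ℂ^m` (`m ≥ 1`) have stabilizer period `|det(stab(w))| = 2`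
(P. Bürgisser, C. Ikenmeyer, *Fundamental invariants of orbit closures*, J. Algebra 477 (2017)
390–434, §2.1, remark after Thm. 2.3: "in the exceptional case `D = 2` of quadratic forms, the orbit
of `X_1² + ⋯ + X_m²` is dense in `Sym²ℂ^m` and the stabilizer of `X_1² + ⋯ + X_m²` equals the complex
orthogonal group, which is not finite. We have `a(2,m) = 2`."; arXiv:1511.02927 TeX L482–486, held
text `paper:arxiv-1511.02927` p0006.txt:L64–67). "Almost all" is the tree's `IsZariskiGeneric 2`:
off the zero set of a nonzero polynomial in the degree-`2` coefficients — here the discriminant.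

## Proof

The printed reason (stabilizer = orthogonal group, `det O_m = {±1}`) made explicit for every
**nondegenerate** quadratic form, without diagonalising:

* a form `f ∈ Sym²` is `½ xᵀ H x` for its (symmetric) Hessian `H = quadHessian f`, and a substitution `γ`
  acts by `H ↦ γ H γᵀ` (`linSubst_quadPoly`, `quadPoly_quadHessian`, `quadHessian_quadPoly`); so `γ ∈ stab(f)` iff
  `γ H γᵀ = H`, whence `det(γ)² = 1` when `disc(f) = det H ≠ 0` (`det_eq_or_of_conj_eq`);
* `-1 ∈ det(stab(f))`: the `H`-reflection `1 - (2 / uᵀHu) (Hu) uᵀ` along a non-isotropic `u` (which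
  exists by polarisation since `H ≠ 0`) preserves `H` and has determinant `-1` (matrix determinant
  lemma) (`exists_reflection`);
* the discriminant `det (quadHessian f)` is a polynomial in the coefficients (`quadHessianPoly`), nonzero at
  `X_1² + ⋯ + X_m²` (Hessian `2·1`).

Hence `det(stab(f)) = {±1}` has order `2` for every quadratic form with nonzero discriminant.
Everything is proved; the three `def`s are private plumbing (`quadPoly`, `quadHessian`, `quadHessianPoly`); no named
facts, no `instance`, no `notation`.

## References

* [BurgisserIkenmeyer2017] P. Bürgisser, C. Ikenmeyer, J. Algebra 477 (2017) = arXiv:1511.02927,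
  §2.1 (stabilizer period, L436; remark after Thm. 2.3, L482–486; held p0006.txt:L64–67).
-/

noncomputable section

open MvPolynomial Matrix

namespace Literature.Computability.AlgebraicComplexity

section Quadratic

variable {m : ℕ}

/-! ### Monomials of degree `1` and `2` -/

/-- A monomial exponent of degree `1` is a single variable (private copy, as in the sibling proof
files, of the tree's `Finsupp.exists_eq_single_of_degree_eq_one`). [folklore] -/
private theorem exists_eq_single_of_degree_eq_one' {d : Fin m →₀ ℕ} (hd : d.degree = 1) :
    ∃ i, d = Finsupp.single i 1 := by
  classical
  have hne : d ≠ 0 := by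
    rintro rfl
    simp at hd
  obtain ⟨i, hi⟩ := Finsupp.ne_iff.1 hne
  simp only [Finsupp.coe_zero, Pi.zero_apply] at hi
  have hsplit := Finsupp.single_add_erase i d
  have hdeg : (Finsupp.single i (d i)).degree + (d.erase i).degree = 1 := by
    rw [← map_add, hsplit, hd]
  rw [Finsupp.degree_single] at hdeg
  have hdi : d i = 1 := by omega
  have herase : (d.erase i).degree = 0 := by omega
  rw [Finsupp.degree_eq_zero_iff] at herase
  refine ⟨i, ?_⟩
  rw [← hsplit, herase, hdi, add_zero]

/-- A monomial exponent of degree `2` is `X_a X_b` (possibly `a = b`). [folklore] -/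
private theorem exists_eq_single_add_single {d : Fin m →₀ ℕ} (hd : d.degree = 2) :
    ∃ a b, d = Finsupp.single a 1 + Finsupp.single b 1 := by
  classical
  have hne : d ≠ 0 := by
    rintro rfl
    simp at hd
  obtain ⟨a, ha⟩ := Finsupp.ne_iff.1 hne
  simp only [Finsupp.coe_zero, Pi.zero_apply] at ha
  have hsplit := Finsupp.single_add_erase a d
  have hdeg : (Finsupp.single a (d a)).degree + (d.erase a).degree = 2 := by
    rw [← map_add, hsplit, hd]
  rw [Finsupp.degree_single] at hdeg
  by_cases h2 : d a = 2
  · have herase : (d.erase a).degree = 0 := by omega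
    rw [Finsupp.degree_eq_zero_iff] at herase
    refine ⟨a, a, ?_⟩
    rw [← Finsupp.single_add, ← hsplit, herase, add_zero, h2]
  · have h1 : d a = 1 := by omega
    have herase : (d.erase a).degree = 1 := by omega
    obtain ⟨b, hb⟩ := exists_eq_single_of_degree_eq_one' herase
    refine ⟨a, b, ?_⟩
    rw [← hsplit, hb, h1]

/-- `X_i X_j = X_a X_b` iff `{i, j} = {a, b}`. [folklore] -/
private theorem single_add_single_eq_iff {i j a b : Fin m} :
    Finsupp.single i 1 + Finsupp.single j 1 = Finsupp.single a 1 + Finsupp.single b 1 ↔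
      (i = a ∧ j = b) ∨ (i = b ∧ j = a) := by
  rw [Finsupp.single_add_single_eq_single_add_single one_ne_zero one_ne_zero]
  constructor
  · rintro (h | ⟨-, h⟩ | ⟨h, -⟩)
    · exact Or.inl h
    · exact Or.inr h
    · exact absurd h (by norm_num)
  · rintro (h | h)
    · exact Or.inl h
    · exact Or.inr (Or.inl ⟨rfl, h⟩)

/-- `X_i X_j` as a monomial. [folklore] -/
private theorem X_mul_X_eq (i j : Fin m) :
    (X i * X j : MvPolynomial (Fin m) ℂ) = monomial (Finsupp.single i 1 + Finsupp.single j 1) 1 := by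
  rw [show (X i : MvPolynomial (Fin m) ℂ) = monomial (Finsupp.single i 1) 1 by
      rw [← X_pow_eq_monomial, pow_one],
    show (X j : MvPolynomial (Fin m) ℂ) = monomial (Finsupp.single j 1) 1 by
      rw [← X_pow_eq_monomial, pow_one],
    monomial_mul, mul_one]

/-- A double Kronecker sum. [folklore] -/
private theorem sum_sum_ite_and (S : Matrix (Fin m) (Fin m) ℂ) (a b : Fin m) :
    (∑ i, ∑ j, if i = a ∧ j = b then S i j else 0) = S a b := by
  have h : ∀ i, (∑ j, if i = a ∧ j = b then S i j else 0) = if i = a then S i b else 0 := by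
    intro i
    by_cases hi : i = a
    · subst hi
      simp
    · simp [hi]
  simp_rw [h]
  simp

/-! ### Quadratic forms and symmetric matrices -/

/-- The quadratic form `xᵀ S x = ∑_{i,j} S_{ij} X_i X_j` of a square matrix. [folklore] -/
private def quadPoly (S : Matrix (Fin m) (Fin m) ℂ) : MvPolynomial (Fin m) ℂ :=
  ∑ i, ∑ j, S i j • (X i * X j)

/-- The Hessian (twice the Gram matrix) of a quadratic form: `H_{ii} = 2 c_{ii}`, `H_{ij} = c_{ij}`
for `f = ∑_{i ≤ j} c_{ij} X_i X_j`. [folklore] -/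
private def quadHessian (f : MvPolynomial (Fin m) ℂ) : Matrix (Fin m) (Fin m) ℂ :=
  fun i j => if i = j then 2 * coeff (Finsupp.single i 2) f
    else coeff (Finsupp.single i 1 + Finsupp.single j 1) f

/-- Diagonal entries of the Hessian. [folklore] -/
private theorem quadHessian_apply_same (f : MvPolynomial (Fin m) ℂ) (i : Fin m) :
    quadHessian f i i = 2 * coeff (Finsupp.single i 2) f :=
  if_pos rfl

/-- Off-diagonal entries of the Hessian. [folklore] -/
private theorem quadHessian_apply_ne (f : MvPolynomial (Fin m) ℂ) {i j : Fin m} (h : i ≠ j) :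
    quadHessian f i j = coeff (Finsupp.single i 1 + Finsupp.single j 1) f :=
  if_neg h

/-- The Hessian is symmetric. [folklore] -/
private theorem quadHessian_transpose (f : MvPolynomial (Fin m) ℂ) :
    (quadHessian f)ᵀ = quadHessian f := by
  ext i j
  rw [transpose_apply]
  by_cases h : i = j
  · subst h
    rfl
  · rw [quadHessian_apply_ne f h, quadHessian_apply_ne f (Ne.symm h), add_comm]

/-- Evaluating `quadPoly`: `(xᵀ S x)(y) = y ⬝ (S y)`. [folklore] -/
private theorem eval_quadPoly (S : Matrix (Fin m) (Fin m) ℂ) (y : Fin m → ℂ) :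
    eval y (quadPoly S) = y ⬝ᵥ (S *ᵥ y) := by
  simp only [quadPoly, map_sum, smul_eval, map_mul, eval_X, dotProduct, mulVec, Finset.mul_sum]
  exact Finset.sum_congr rfl fun i _ => Finset.sum_congr rfl fun j _ => by ring

/-- Evaluating a linear substitution: `(M · f)(x) = f(Mᵀ x)` (private copy, as in
`CharacterizedByStabilizerSL.lean`). [folklore] -/
private theorem eval_linSubst' (M : Matrix (Fin m) (Fin m) ℂ) (x : Fin m → ℂ)
    (f : MvPolynomial (Fin m) ℂ) : eval x (linSubst (Fin m) ℂ M f) = eval (Mᵀ *ᵥ x) f := by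
  induction f using MvPolynomial.induction_on with
  | C a => rw [linSubst_C, eval_C, eval_C]
  | add p q hp hq => rw [map_add, map_add, map_add, hp, hq]
  | mul_X p i hp =>
    rw [map_mul, map_mul, map_mul, hp, linSubst_X, eval_X]
    congr 1
    simp [mulVec, dotProduct, smul_eval]

/-- **Substitutions act on Gram matrices by congruence**: `A · (xᵀ S x) = xᵀ (A S Aᵀ) x`.
[folklore] -/
private theorem linSubst_quadPoly (A S : Matrix (Fin m) (Fin m) ℂ) :
    linSubst (Fin m) ℂ A (quadPoly S) = quadPoly (A * S * Aᵀ) := by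
  apply MvPolynomial.funext
  intro x
  rw [eval_linSubst', eval_quadPoly, eval_quadPoly, mulVec_transpose, ← mulVec_mulVec,
    ← mulVec_mulVec, mulVec_transpose, dotProduct_mulVec x A]

/-- The coefficients of `quadPoly S`. [folklore] -/
private theorem coeff_quadPoly (S : Matrix (Fin m) (Fin m) ℂ) (d : Fin m →₀ ℕ) :
    coeff d (quadPoly S) =
      ∑ i, ∑ j, if Finsupp.single i 1 + Finsupp.single j 1 = d then S i j else 0 := by
  simp only [quadPoly, coeff_sum, coeff_smul, X_mul_X_eq, coeff_monomial, smul_eq_mul, mul_ite,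
    mul_one, mul_zero]

/-- The coefficient of `X_a X_b`, `a ≠ b`, in `xᵀ S x` is `S_{ab} + S_{ba}`. [folklore] -/
private theorem coeff_quadPoly_offDiag (S : Matrix (Fin m) (Fin m) ℂ) {a b : Fin m} (hab : a ≠ b) :
    coeff (Finsupp.single a 1 + Finsupp.single b 1) (quadPoly S) = S a b + S b a := by
  rw [coeff_quadPoly]
  have h : ∀ i j : Fin m,
      (if Finsupp.single i 1 + Finsupp.single j 1 = Finsupp.single a 1 + Finsupp.single b 1
        then S i j else 0) =
        (if i = a ∧ j = b then S i j else 0) + (if i = b ∧ j = a then S i j else 0) := by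
    intro i j
    by_cases h1 : i = a ∧ j = b
    · have h2 : ¬(i = b ∧ j = a) := fun h2 => hab (h1.1.symm.trans h2.1)
      rw [if_pos (single_add_single_eq_iff.mpr (Or.inl h1)), if_pos h1, if_neg h2, add_zero]
    · by_cases h2 : i = b ∧ j = a
      · rw [if_pos (single_add_single_eq_iff.mpr (Or.inr h2)), if_neg h1, if_pos h2, zero_add]
      · rw [if_neg (fun h => (single_add_single_eq_iff.mp h).elim h1 h2), if_neg h1, if_neg h2,
          add_zero]
  simp_rw [h, Finset.sum_add_distrib, sum_sum_ite_and]

/-- The coefficient of `X_a²` in `xᵀ S x` is `S_{aa}`. [folklore] -/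
private theorem coeff_quadPoly_diag (S : Matrix (Fin m) (Fin m) ℂ) (a : Fin m) :
    coeff (Finsupp.single a 2) (quadPoly S) = S a a := by
  rw [coeff_quadPoly]
  have key : ∀ i j : Fin m,
      Finsupp.single i 1 + Finsupp.single j 1 = Finsupp.single a 2 ↔ i = a ∧ j = a := by
    intro i j
    rw [show (Finsupp.single a 2 : Fin m →₀ ℕ) = Finsupp.single a 1 + Finsupp.single a 1 by
      rw [← Finsupp.single_add], single_add_single_eq_iff, or_self_iff]
  have h : ∀ i j : Fin m,
      (if Finsupp.single i 1 + Finsupp.single j 1 = Finsupp.single a 2 then S i j else 0) =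
        if i = a ∧ j = a then S i j else 0 := by
    intro i j
    by_cases h1 : i = a ∧ j = a
    · rw [if_pos ((key i j).mpr h1), if_pos h1]
    · rw [if_neg (fun h => h1 ((key i j).mp h)), if_neg h1]
  simp_rw [h, sum_sum_ite_and]

/-- **The Hessian of `xᵀ S x` is `S + Sᵀ`.** [folklore] -/
private theorem quadHessian_quadPoly (S : Matrix (Fin m) (Fin m) ℂ) :
    quadHessian (quadPoly S) = S + Sᵀ := by
  ext i j
  rw [Matrix.add_apply, transpose_apply]
  by_cases h : i = j
  · subst h
    rw [quadHessian_apply_same, coeff_quadPoly_diag, two_mul]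
  · rw [quadHessian_apply_ne _ h, coeff_quadPoly_offDiag S h]

/-- **A quadratic form is half its Hessian form**: `xᵀ (quadHessian f) x = 2 f` for `f ∈ Sym²`.
[folklore] -/
private theorem quadPoly_quadHessian {f : MvPolynomial (Fin m) ℂ} (hf : f.IsHomogeneous 2) :
    quadPoly (quadHessian f) = (2 : ℂ) • f := by
  ext d
  rw [coeff_smul, smul_eq_mul]
  by_cases hd : d.degree = 2
  · obtain ⟨a, b, rfl⟩ := exists_eq_single_add_single hd
    by_cases hab : a = b
    · subst hab
      rw [← Finsupp.single_add, coeff_quadPoly_diag, quadHessian_apply_same]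
    · rw [coeff_quadPoly_offDiag _ hab, quadHessian_apply_ne f hab,
        quadHessian_apply_ne f (Ne.symm hab), add_comm (Finsupp.single b 1), ← two_mul]
  · rw [hf.coeff_eq_zero hd, mul_zero, coeff_quadPoly]
    refine Finset.sum_eq_zero fun i _ => Finset.sum_eq_zero fun j _ => if_neg fun h => hd ?_
    rw [← h, map_add, Finsupp.degree_single, Finsupp.degree_single]

/-- **`γ · f = f` forces `γ H γᵀ = H`** for the Hessian `H` of a quadratic form `f`. [folklore] -/
private theorem conj_quadHessian_eq_of_linSubst_eq {f : MvPolynomial (Fin m) ℂ}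
    (hf : f.IsHomogeneous 2) {A : Matrix (Fin m) (Fin m) ℂ} (hA : linSubst (Fin m) ℂ A f = f) :
    A * quadHessian f * Aᵀ = quadHessian f := by
  have h1 : quadPoly (A * quadHessian f * Aᵀ) = quadPoly (quadHessian f) := by
    rw [← linSubst_quadPoly, quadPoly_quadHessian hf, map_smul, hA]
  have h2 := congrArg quadHessian h1
  rw [quadHessian_quadPoly, quadHessian_quadPoly, transpose_mul, transpose_mul, transpose_transpose,
    quadHessian_transpose, ← Matrix.mul_assoc, ← two_smul ℂ, ← two_smul ℂ (quadHessian f)] at h2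
  exact smul_right_injective (Matrix (Fin m) (Fin m) ℂ) (two_ne_zero (α := ℂ)) h2

/-- **`A H Aᵀ = H` forces `A · f = f`** (converse direction, `char ℂ = 0`). [folklore] -/
private theorem linSubst_eq_of_conj_quadHessian_eq {f : MvPolynomial (Fin m) ℂ} (hf : f.IsHomogeneous 2)
    {A : Matrix (Fin m) (Fin m) ℂ} (hA : A * quadHessian f * Aᵀ = quadHessian f) :
    linSubst (Fin m) ℂ A f = f := by
  apply smul_right_injective (MvPolynomial (Fin m) ℂ) (two_ne_zero (α := ℂ))
  change (2 : ℂ) • linSubst (Fin m) ℂ A f = (2 : ℂ) • f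
  rw [← map_smul, ← quadPoly_quadHessian hf, linSubst_quadPoly, hA]

/-- **`A H Aᵀ = H` with `det H ≠ 0` forces `det A = ±1`.** [folklore] -/
private theorem det_eq_or_of_conj_eq {A H : Matrix (Fin m) (Fin m) ℂ} (hA : A * H * Aᵀ = H)
    (hH : H.det ≠ 0) : A.det = 1 ∨ A.det = -1 := by
  have h1 := congrArg Matrix.det hA
  rw [det_mul, det_mul, det_transpose] at h1
  have h2 : (A.det ^ 2 - 1) * H.det = 0 := by linear_combination h1
  rcases mul_eq_zero.mp h2 with h | h
  · exact sq_eq_one_iff.mp (sub_eq_zero.mp h)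
  · exact absurd h hH

/-- **Non-isotropic vectors exist** for a nonzero symmetric matrix (polarisation, `char ≠ 2`).
[folklore] -/
private theorem exists_dotProduct_mulVec_ne_zero {H : Matrix (Fin m) (Fin m) ℂ} (hH : Hᵀ = H)
    (hH0 : H ≠ 0) : ∃ u : Fin m → ℂ, u ⬝ᵥ (H *ᵥ u) ≠ 0 := by
  by_contra hall
  simp only [not_exists, ne_eq, not_not] at hall
  apply hH0
  have hsymm : ∀ x y : Fin m → ℂ, y ⬝ᵥ (H *ᵥ x) = x ⬝ᵥ (H *ᵥ y) := by
    intro x y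
    rw [dotProduct_mulVec, ← mulVec_transpose, hH, dotProduct_comm]
  have hpol : ∀ x y : Fin m → ℂ, x ⬝ᵥ (H *ᵥ y) = 0 := by
    intro x y
    have h := hall (x + y)
    rw [mulVec_add, add_dotProduct, dotProduct_add, dotProduct_add, hall x, hall y, hsymm x y,
      zero_add, add_zero, ← two_mul] at h
    exact (mul_eq_zero.mp h).resolve_left two_ne_zero
  ext i j
  have := hpol (Pi.single i 1) (Pi.single j 1)
  rwa [mulVec_single_one, single_one_dotProduct] at this

/-- **The reflection along a non-isotropic vector**: for symmetric `H` and `uᵀ H u ≠ 0`, the matrix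
`A = 1 - (2 / uᵀHu) (Hu) uᵀ` satisfies `A H Aᵀ = H` and `det A = -1` (matrix determinant lemma).
[folklore] -/
private theorem exists_reflection {H : Matrix (Fin m) (Fin m) ℂ} (hH : Hᵀ = H) {u : Fin m → ℂ}
    (hu : u ⬝ᵥ (H *ᵥ u) ≠ 0) :
    ∃ A : Matrix (Fin m) (Fin m) ℂ, A * H * Aᵀ = H ∧ A.det = -1 := by
  set v : Fin m → ℂ := H *ᵥ u with hv
  set q : ℂ := u ⬝ᵥ v with hq
  set c : ℂ := 2 / q with hc
  have hcq : c * q = 2 := div_mul_cancel₀ 2 hu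
  have huH : u ᵥ* H = v := by rw [hv, ← mulVec_transpose, hH]
  set w : Fin m → ℂ := c • v with hw
  refine ⟨1 - vecMulVec w u, ?_, ?_⟩
  · have h1 : (1 - vecMulVec w u) * H = H - vecMulVec w v := by
      rw [Matrix.sub_mul, Matrix.one_mul, vecMulVec_mul, huH]
    have h2 : H * vecMulVec u w = vecMulVec v w := by rw [mul_vecMulVec]
    have h3 : vecMulVec w v * vecMulVec u w = q • vecMulVec w w := by
      rw [vecMulVec_mul_vecMulVec, vecMulVec_smul, dotProduct_comm, ← hq]
    have h4 : vecMulVec w v = c • vecMulVec v v := by rw [hw, smul_vecMulVec]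
    have h5 : vecMulVec v w = c • vecMulVec v v := by rw [hw, vecMulVec_smul]
    have h6 : vecMulVec w w = (c * c) • vecMulVec v v := by
      rw [hw, smul_vecMulVec, vecMulVec_smul, smul_smul]
    have hcoef : q * (c * c) - c - c = 0 := by
      have : q * (c * c) = c * q * c := by ring
      rw [this, hcq]
      ring
    calc (1 - vecMulVec w u) * H * (1 - vecMulVec w u)ᵀ
        = (H - vecMulVec w v) * (1 - vecMulVec u w) := by
          rw [h1, transpose_sub, transpose_one, transpose_vecMulVec]
      _ = H - vecMulVec v w - vecMulVec w v + q • vecMulVec w w := by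
          rw [Matrix.mul_sub, Matrix.mul_one, Matrix.sub_mul, h2, h3]
          abel
      _ = H + (q * (c * c) - c - c) • vecMulVec v v := by
          rw [h4, h5, h6, smul_smul]
          module
      _ = H := by rw [hcoef, zero_smul, add_zero]
  · rw [vecMulVec_eq Unit, det_one_sub_mul_comm, det_unique, Matrix.sub_apply, one_apply_eq,
      replicateRow_mul_replicateCol_apply, hw, dotProduct_smul, smul_eq_mul, ← hq, hcq]
    norm_num

/-! ### The discriminant as a polynomial in the coefficients -/

/-- The Hessian with polynomial entries: the matrix of coordinate functions on `Sym²` whose value at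
`formCoeff 2 f` is `quadHessian f`. [folklore] -/
private def quadHessianPoly (m : ℕ) : Matrix (Fin m) (Fin m) (MvPolynomial (DegIdx (Fin m) 2) ℂ) :=
  fun i j => if i = j then
      2 * X ⟨Finsupp.single i 2, mem_degMonomials_iff.mpr (Finsupp.degree_single i 2)⟩
    else X ⟨Finsupp.single i 1 + Finsupp.single j 1, mem_degMonomials_iff.mpr (by
      rw [map_add, Finsupp.degree_single, Finsupp.degree_single])⟩

/-- The discriminant `det (quadHessianPoly m)` evaluates at a form to `det (quadHessian f)`. [folklore] -/
private theorem aeval_det_quadHessianPoly (f : MvPolynomial (Fin m) ℂ) :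
    aeval (formCoeff 2 f) (quadHessianPoly m).det = (quadHessian f).det := by
  rw [AlgHom.map_det]
  congr 1
  ext i j
  simp only [AlgHom.mapMatrix_apply, map_apply, quadHessianPoly, quadHessian]
  split_ifs with h
  · rw [map_mul, aeval_X, formCoeff_apply, map_ofNat]
  · rw [aeval_X, formCoeff_apply]

/-- The Hessian of `X_1² + ⋯ + X_m²` is `2·1`. [folklore] -/
private theorem quadHessian_sumSq :
    quadHessian (∑ i : Fin m, X i ^ 2 : MvPolynomial (Fin m) ℂ) = (2 : ℂ) • (1 : Matrix (Fin m) (Fin m) ℂ) := by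
  have hc : ∀ d : Fin m →₀ ℕ, coeff d (∑ i : Fin m, X i ^ 2 : MvPolynomial (Fin m) ℂ) =
      ∑ i : Fin m, if Finsupp.single i 2 = d then 1 else 0 := by
    intro d
    simp only [coeff_sum, X_pow_eq_monomial, coeff_monomial]
  ext i j
  rw [Matrix.smul_apply, one_apply, smul_eq_mul, mul_ite, mul_one, mul_zero]
  by_cases h : i = j
  · subst h
    rw [if_pos rfl, quadHessian_apply_same, hc, Finset.sum_eq_single i, if_pos rfl, mul_one]
    · intro k _ hk
      exact if_neg fun e => hk (Finsupp.single_left_injective (by norm_num) e)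
    · intro hi
      exact absurd (Finset.mem_univ i) hi
  · rw [if_neg h, quadHessian_apply_ne _ h, hc]
    refine Finset.sum_eq_zero fun k _ => if_neg fun e => ?_
    have := congrArg (fun d : Fin m →₀ ℕ => d i) e
    simp only [Finsupp.single_apply, Finsupp.coe_add, Pi.add_apply, if_neg (Ne.symm h)] at this
    split_ifs at this; omega

/-- The discriminant polynomial is not zero (it is `2^m` at `X_1² + ⋯ + X_m²`). [folklore] -/
private theorem det_quadHessianPoly_ne_zero : (quadHessianPoly m).det ≠ 0 := by
  intro h
  have := aeval_det_quadHessianPoly (∑ i : Fin m, X i ^ 2 : MvPolynomial (Fin m) ℂ)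
  rw [h, map_zero, quadHessian_sumSq, det_smul, det_one, mul_one, Fintype.card_fin] at this
  exact pow_ne_zero m two_ne_zero this.symm

/-! ### Nondegenerate quadratic forms have stabilizer period `2` -/

/-- **`det(stab(f)) = {±1}` for a nondegenerate quadratic form** `f` in `m ≥ 1` variables, so its
stabilizer period is `2` (the printed "stabilizer = complex orthogonal group", for every form with
nonzero discriminant). [cite: BurgisserIkenmeyer2017, §2.1 (remark after Thm. 2.3, TeX L482–486)] -/
theorem stabilizerPeriod_eq_two_of_det_quadHessian_ne_zero (hm : 1 ≤ m) {f : MvPolynomial (Fin m) ℂ}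
    (hf : f.IsHomogeneous 2) (hdet : (quadHessian f).det ≠ 0) : stabilizerPeriod f = 2 := by
  classical
  -- every stabilizer element has determinant `±1`
  have hsq : ∀ γ : GL (Fin m) ℂ, γ ∈ linStabilizer f →
      (γ : Matrix (Fin m) (Fin m) ℂ).det = 1 ∨ (γ : Matrix (Fin m) (Fin m) ℂ).det = -1 := by
    intro γ hγ
    have hγf : linSubst (Fin m) ℂ (γ : Matrix (Fin m) (Fin m) ℂ) f = f := by
      have := mem_linStabilizer.mp hγ
      rwa [linSubstRep_apply] at this
    exact det_eq_or_of_conj_eq (conj_quadHessian_eq_of_linSubst_eq hf hγf) hdet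
  -- a stabilizer element of determinant `-1`
  haveI : Nonempty (Fin m) := ⟨⟨0, hm⟩⟩
  have hH0 : quadHessian f ≠ 0 := by
    rintro h
    rw [h, det_zero] at hdet
    exact hdet rfl
  obtain ⟨u, hu⟩ := exists_dotProduct_mulVec_ne_zero (quadHessian_transpose f) hH0
  obtain ⟨A, hAH, hAdet⟩ := exists_reflection (quadHessian_transpose f) hu
  have hAne : A.det ≠ 0 := by
    rw [hAdet]
    norm_num
  set γ₀ : GL (Fin m) ℂ := Matrix.GeneralLinearGroup.mkOfDetNeZero A hAne with hγ₀
  have hγ₀A : (γ₀ : Matrix (Fin m) (Fin m) ℂ) = A := rfl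
  have hγ₀mem : γ₀ ∈ linStabilizer f := by
    rw [mem_linStabilizer, linSubstRep_apply, hγ₀A]
    exact linSubst_eq_of_conj_quadHessian_eq hf hAH
  have hneg : (-1 : ℂˣ) ∈ stabilizerDetImage f := by
    refine Subgroup.mem_map.mpr ⟨γ₀, hγ₀mem, Units.ext ?_⟩
    rw [Matrix.GeneralLinearGroup.val_det_apply, hγ₀A, hAdet, Units.val_neg, Units.val_one]
  -- hence `det(stab(f)) = {1, -1}`
  rw [stabilizerPeriod_def, Nat.card_eq_two_iff]
  refine ⟨⟨1, one_mem _⟩, ⟨-1, hneg⟩, ?_, Set.eq_univ_of_forall ?_⟩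
  · intro h
    have h' := congrArg (fun z : stabilizerDetImage f => ((z : ℂˣ) : ℂ)) h
    norm_num at h'
  · rintro ⟨z, hz⟩
    simp only [Set.mem_insert_iff, Set.mem_singleton_iff, Subtype.mk.injEq]
    obtain ⟨γ, hγ, hγz⟩ := Subgroup.mem_map.mp hz
    have hval : (z : ℂ) = (γ : Matrix (Fin m) (Fin m) ℂ).det := by
      rw [← hγz, Matrix.GeneralLinearGroup.val_det_apply]
    rcases hsq γ hγ with h | h
    · left
      exact Units.ext (by rw [hval, h, Units.val_one])
    · right
      exact Units.ext (by rw [hval, h, Units.val_neg, Units.val_one])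

end Quadratic

/-! ### The discharge -/

/-- **Bürgisser–Ikenmeyer 2017, §2.1, `a(2,m) = 2`, discharged**: almost all quadratic forms in
`m ≥ 1` variables have stabilizer period `2` — precisely, every form off the discriminant hypersurface
`det (quadHessian f) = 0` (a nonzero polynomial in the degree-`2` coefficients, `2^m` at `X_1² + ⋯ + X_m²`),
since its stabilizer maps onto `{±1}` under `det` (congruence `γ H γᵀ = H` gives `det γ = ±1`; an
`H`-reflection gives `-1`). [cite: BurgisserIkenmeyer2017, §2.1 (remark after Thm. 2.3: "We have a(2,m) = 2", TeX L482–486; held paper:arxiv-1511.02927 p0006.txt:L64–67)] -/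
theorem BI2017_rem_quadratic_period_holds : BI2017_rem_quadratic_period := by
  intro m hm
  refine ⟨(quadHessianPoly m).det, det_quadHessianPoly_ne_zero, fun f hf hF => ?_⟩
  rw [aeval_det_quadHessianPoly] at hF
  exact stabilizerPeriod_eq_two_of_det_quadHessian_ne_zero hm hf hF

end Literature.Computability.AlgebraicComplexity

end
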